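import Summits.ValiantsHypothesis.ValiantsHypothesis.Theorems.LacunarySymmetroidMatrixDescartesFanLawFourAlt

/-!
# `MatrixDescartes` (stmt-ValiantsHypothesis-18050), line `Lift` — the signed fan law with TWO FREE EXPONENTS
# (word form: every letter at the pivot exponent or at the factoring exponent is unconstrained)

HONEST FRAMING.  Cell `pub-symmetroid`, seat `val-sym-mdr-p2` (gen 3); helper `--supports` the crux
`Theses.LacunarySymmetroid.MatrixDescartes`, NO closure claim.  Repackaging of `…FanLawFour.lean` / `…FanLawFourAlt.lean`
for arbitrary words `∑ₗ X^{dₗ} Sₗ` (`K` letters, `m × m`, any multiplicities of exponents): since the pivot letter and the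
factoring letter of the signed fan law are ARBITRARY symmetric matrices, all letters sitting at the pivot exponent `E`
merge into the pivot and all letters at the factoring exponent `Ef` merge into the factoring letter.  A K-free SECTOR
law; nothing here bears on `stub_twoSided` in general, the crux in its window, `DoorA26`/`DoorA34`, or `VP ≠ VNP`.

**SIGNED WORD LAW** (`signedWord_posRoots_le`, alternation form `signedWord_alternation_le`).  Choose two exponents
`E ≠ Ef`, `a := |E − Ef|`.  Letters with `dₗ ∈ {E, Ef}`: any real symmetric matrices.  Every other letter semidefinite
with the sign of its position: on the side of `E` away from `Ef` with gap `≤ a`: `⪰ 0`; on the side of `Ef`, between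
`Ef` and `E`: `⪯ 0`; beyond `Ef` with gap from `E` in `(a, 2a]`: `⪰ 0`; nothing farther.  Then (i) with one definite
such letter, `Z₊ ≤ 2m`; (ii) with none assumed definite, `det` alternates in sign along at most `2m + 1` positive
points.  [folklore] given `…FanLawFour*`.
-/

-- layout Summits/ValiantsHypothesis/ValiantsHypothesis forces the duplicated namespace component
set_option linter.dupNamespace false

namespace Summit.ValiantsHypothesis.ValiantsHypothesis.Theorems.LacunarySymmetroidMatrixDescartes

open Polynomial Matrix Finset
open scoped BigOperators

namespace FanLawFourWord

variable {K m : ℕ}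

/-- `Matrix.map Polynomial.C` commutes with finite sums. [folklore] -/
theorem map_C_sum {ι : Type*} (s : Finset ι) (S : ι → Matrix (Fin m) (Fin m) ℝ) :
    (∑ l ∈ s, S l).map Polynomial.C = ∑ l ∈ s, (S l).map Polynomial.C := by
  have h : (∑ l ∈ s, S l).map Polynomial.C = (Polynomial.C : ℝ →+* ℝ[X]).mapMatrix (∑ l ∈ s, S l) := rfl
  rw [h, map_sum]
  rfl

/-- Regrouping a word at two exponents: the letters at `E` form the pivot, the letters at `Ef` form the factoring
letter (index `inr ()` at exponent `Ef`), the rest keep their exponents. [folklore] -/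
theorem word_regroup (d : Fin K → ℕ) (S : Fin K → Matrix (Fin m) (Fin m) ℝ) (E Ef : ℕ) (hEf : Ef ≠ E) :
    ∑ l, ((Polynomial.X : Polynomial ℝ) ^ d l) • (S l).map Polynomial.C
      = ((Polynomial.X : Polynomial ℝ) ^ E) • (∑ l ∈ Finset.univ.filter (fun l => d l = E), S l).map Polynomial.C
        + ∑ x : {l // d l ≠ E ∧ d l ≠ Ef} ⊕ Unit,
            ((Polynomial.X : Polynomial ℝ) ^ (Sum.elim (fun l => d l.1) (fun _ => Ef) x))
              • (Sum.elim (fun l => S l.1) (fun _ => ∑ l ∈ Finset.univ.filter (fun l => d l = Ef), S l) x).map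
                Polynomial.C := by
  classical
  rw [Fintype.sum_sum_type]
  simp only [Sum.elim_inl, Sum.elim_inr, Finset.univ_unique, Finset.sum_singleton]
  rw [← Finset.sum_filter_add_sum_filter_not Finset.univ (fun l => d l = E),
    ← Finset.sum_filter_add_sum_filter_not (Finset.univ.filter (fun l => ¬ d l = E)) (fun l => d l = Ef)]
  have h1 : ∑ l ∈ Finset.univ.filter (fun l => d l = E), ((Polynomial.X : Polynomial ℝ) ^ d l) • (S l).map Polynomial.C
      = ((Polynomial.X : Polynomial ℝ) ^ E) • (∑ l ∈ Finset.univ.filter (fun l => d l = E), S l).map Polynomial.C := by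
    rw [map_C_sum, Finset.smul_sum]
    refine Finset.sum_congr rfl fun l hl => ?_
    rw [(Finset.mem_filter.1 hl).2]
  have h2 : ∑ l ∈ (Finset.univ.filter (fun l => ¬ d l = E)).filter (fun l => d l = Ef),
        ((Polynomial.X : Polynomial ℝ) ^ d l) • (S l).map Polynomial.C
      = ((Polynomial.X : Polynomial ℝ) ^ Ef) • (∑ l ∈ Finset.univ.filter (fun l => d l = Ef), S l).map Polynomial.C := by
    have hset : (Finset.univ.filter (fun l => ¬ d l = E)).filter (fun l => d l = Ef)
        = Finset.univ.filter (fun l => d l = Ef) := by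
      ext l
      simp only [Finset.mem_filter, Finset.mem_univ, true_and]
      constructor
      · exact fun h => h.2
      · intro h
        exact ⟨by rw [h]; exact hEf, h⟩
    rw [hset, map_C_sum, Finset.smul_sum]
    refine Finset.sum_congr rfl fun l hl => ?_
    rw [(Finset.mem_filter.1 hl).2]
  have h3 : ∑ l ∈ (Finset.univ.filter (fun l => ¬ d l = E)).filter (fun l => ¬ d l = Ef),
        ((Polynomial.X : Polynomial ℝ) ^ d l) • (S l).map Polynomial.C
      = ∑ x : {l // d l ≠ E ∧ d l ≠ Ef}, ((Polynomial.X : Polynomial ℝ) ^ d x.1) • (S x.1).map Polynomial.C := by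
    rw [Finset.sum_subtype ((Finset.univ.filter (fun l => ¬ d l = E)).filter (fun l => ¬ d l = Ef))
        (p := fun l => d l ≠ E ∧ d l ≠ Ef) (fun l => by simp [Finset.mem_filter])]
  rw [h1, h2, h3]
  abel

/-- **Signed word law, definite form**: `Z₊ ≤ 2m`. [folklore] -/
theorem signedWord_posRoots_le (d : Fin K → ℕ) (S : Fin K → Matrix (Fin m) (Fin m) ℝ) (E Ef : ℕ) (hEf : Ef ≠ E)
    (hfree : ∀ l, d l = E ∨ d l = Ef → (S l).IsSymm)
    (hfan : ∀ l, d l ≠ E → d l ≠ Ef →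
      ((Ef < E ∧ ((E < d l ∧ d l - E ≤ E - Ef ∧ (S l).PosSemidef)
          ∨ (d l < E ∧ E - d l < E - Ef ∧ (-S l).PosSemidef)
          ∨ (d l < E ∧ E - Ef < E - d l ∧ E - d l ≤ 2 * (E - Ef) ∧ (S l).PosSemidef)))
      ∨ (E < Ef ∧ ((d l < E ∧ E - d l ≤ Ef - E ∧ (S l).PosSemidef)
          ∨ (E < d l ∧ d l - E < Ef - E ∧ (-S l).PosSemidef)
          ∨ (E < d l ∧ Ef - E < d l - E ∧ d l - E ≤ 2 * (Ef - E) ∧ (S l).PosSemidef)))))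
    (hdef : ∃ l, d l ≠ E ∧ d l ≠ Ef ∧
      (((S l).PosDef ∧ ¬ ((Ef < E ∧ d l < E ∧ E - d l < E - Ef) ∨ (E < Ef ∧ E < d l ∧ d l - E < Ef - E)))
        ∨ ((-S l).PosDef ∧ ((Ef < E ∧ d l < E ∧ E - d l < E - Ef) ∨ (E < Ef ∧ E < d l ∧ d l - E < Ef - E))))) :
    ((Matrix.det (∑ l, ((Polynomial.X : Polynomial ℝ) ^ d l) • (S l).map Polynomial.C)).roots.toFinset.filter
        (fun t => 0 < t)).card ≤ 2 * m := by
  classical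
  rw [word_regroup d S E Ef hEf]
  have hJ : (∑ l ∈ Finset.univ.filter (fun l => d l = E), S l).IsSymm := by
    unfold Matrix.IsSymm
    rw [Matrix.transpose_sum]
    exact Finset.sum_congr rfl fun l hl => (hfree l (Or.inl (Finset.mem_filter.1 hl).2)).eq
  have hP₀ : (Sum.elim (fun l : {l // d l ≠ E ∧ d l ≠ Ef} => S l.1)
      (fun _ => ∑ l ∈ Finset.univ.filter (fun l => d l = Ef), S l) (Sum.inr ())).IsSymm := by
    simp only [Sum.elim_inr]
    unfold Matrix.IsSymm
    rw [Matrix.transpose_sum]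
    exact Finset.sum_congr rfl fun l hl => (hfree l (Or.inr (Finset.mem_filter.1 hl).2)).eq
  obtain ⟨l₁, hl₁E, hl₁f, hl₁⟩ := hdef
  rcases Nat.lt_or_gt_of_ne hEf with hlt | hgt
  · -- factoring exponent below the pivot
    have := FanLawFour.fanLawFour_lower (κ := {l // d l ≠ E ∧ d l ≠ Ef} ⊕ Unit) E
      (Sum.elim (fun l => d l.1) (fun _ => Ef))
      (∑ l ∈ Finset.univ.filter (fun l => d l = E), S l)
      (Sum.elim (fun l => S l.1) (fun _ => ∑ l ∈ Finset.univ.filter (fun l => d l = Ef), S l)) (Sum.inr ())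
      hJ hP₀ (by simpa using hlt) (fun k hk => ?_) ⟨Sum.inl ⟨l₁, hl₁E, hl₁f⟩, by simp, ?_⟩
    · simpa using this
    · rcases k with l | u
      · simp only [Sum.elim_inl, Sum.elim_inr]
        rcases hfan l.1 l.2.1 l.2.2 with ⟨_, h⟩ | ⟨h, _⟩
        · rcases h with ⟨h1, h2, h3⟩ | ⟨h1, h2, h3⟩ | ⟨h1, h2, h3, h4⟩
          · rcases Nat.lt_or_eq_of_le h2 with h' | h'
            · exact Or.inl ⟨h1, h', h3⟩
            · exact Or.inr (Or.inl ⟨by omega, h3⟩)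
          · exact Or.inr (Or.inr (Or.inl ⟨h1, h2, h3⟩))
          · rcases Nat.lt_or_eq_of_le h3 with h' | h'
            · exact Or.inr (Or.inr (Or.inr (Or.inl ⟨h1, h2, h', h4⟩)))
            · exact Or.inr (Or.inr (Or.inr (Or.inr ⟨by omega, h4⟩)))
        · exact absurd h (by omega)
      · exact absurd rfl hk
    · simp only [Sum.elim_inl, Sum.elim_inr]
      rcases hl₁ with ⟨hpd, hn⟩ | ⟨hnd, hw⟩
      · exact Or.inl ⟨hpd, fun hc => hn (Or.inl ⟨hlt, hc⟩)⟩
      · refine Or.inr ⟨hnd, ?_⟩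
        rcases hw with ⟨_, hw⟩ | ⟨hw, _⟩
        · exact hw
        · exact absurd hw (by omega)
  · -- factoring exponent above the pivot
    have := FanLawFour.fanLawFour_upper (κ := {l // d l ≠ E ∧ d l ≠ Ef} ⊕ Unit) E
      (Sum.elim (fun l => d l.1) (fun _ => Ef))
      (∑ l ∈ Finset.univ.filter (fun l => d l = E), S l)
      (Sum.elim (fun l => S l.1) (fun _ => ∑ l ∈ Finset.univ.filter (fun l => d l = Ef), S l)) (Sum.inr ())
      hJ hP₀ (by simpa using hgt) (fun k hk => ?_) ⟨Sum.inl ⟨l₁, hl₁E, hl₁f⟩, by simp, ?_⟩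
    · simpa using this
    · rcases k with l | u
      · simp only [Sum.elim_inl, Sum.elim_inr]
        rcases hfan l.1 l.2.1 l.2.2 with ⟨h, _⟩ | ⟨_, h⟩
        · exact absurd h (by omega)
        · rcases h with ⟨h1, h2, h3⟩ | ⟨h1, h2, h3⟩ | ⟨h1, h2, h3, h4⟩
          · rcases Nat.lt_or_eq_of_le h2 with h' | h'
            · exact Or.inl ⟨h1, h', h3⟩
            · exact Or.inr (Or.inl ⟨by omega, h3⟩)
          · exact Or.inr (Or.inr (Or.inl ⟨h1, h2, h3⟩))
          · rcases Nat.lt_or_eq_of_le h3 with h' | h'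
            · exact Or.inr (Or.inr (Or.inr (Or.inl ⟨h1, h2, h', h4⟩)))
            · exact Or.inr (Or.inr (Or.inr (Or.inr ⟨by omega, h4⟩)))
      · exact absurd rfl hk
    · simp only [Sum.elim_inl, Sum.elim_inr]
      rcases hl₁ with ⟨hpd, hn⟩ | ⟨hnd, hw⟩
      · exact Or.inl ⟨hpd, fun hc => hn (Or.inr ⟨hgt, hc⟩)⟩
      · refine Or.inr ⟨hnd, ?_⟩
        rcases hw with ⟨hw, _⟩ | ⟨_, hw⟩
        · exact absurd hw (by omega)
        · exact hw

/-- **Signed word law, alternation form (no definiteness)**: `det` alternates in sign along at most `2m + 1` positive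
points. [folklore] -/
theorem signedWord_alternation_le (d : Fin K → ℕ) (S : Fin K → Matrix (Fin m) (Fin m) ℝ) (E Ef : ℕ) (hEf : Ef ≠ E)
    (hfree : ∀ l, d l = E ∨ d l = Ef → (S l).IsSymm)
    (hfan : ∀ l, d l ≠ E → d l ≠ Ef →
      ((Ef < E ∧ ((E < d l ∧ d l - E ≤ E - Ef ∧ (S l).PosSemidef)
          ∨ (d l < E ∧ E - d l < E - Ef ∧ (-S l).PosSemidef)
          ∨ (d l < E ∧ E - Ef < E - d l ∧ E - d l ≤ 2 * (E - Ef) ∧ (S l).PosSemidef)))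
      ∨ (E < Ef ∧ ((d l < E ∧ E - d l ≤ Ef - E ∧ (S l).PosSemidef)
          ∨ (E < d l ∧ d l - E < Ef - E ∧ (-S l).PosSemidef)
          ∨ (E < d l ∧ Ef - E < d l - E ∧ d l - E ≤ 2 * (Ef - E) ∧ (S l).PosSemidef)))))
    (N : ℕ) (τ : Fin (N + 1) → ℝ) (hτ : StrictMono τ) (hτpos : ∀ j, 0 < τ j)
    (halt : ∀ j : Fin N,
      (Matrix.det (∑ l, ((Polynomial.X : Polynomial ℝ) ^ d l) • (S l).map Polynomial.C)).eval (τ j.castSucc)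
      * (Matrix.det (∑ l, ((Polynomial.X : Polynomial ℝ) ^ d l) • (S l).map Polynomial.C)).eval (τ j.succ)
        < 0) :
    N ≤ 2 * m := by
  classical
  rw [word_regroup d S E Ef hEf] at halt
  have hJ : (∑ l ∈ Finset.univ.filter (fun l => d l = E), S l).IsSymm := by
    unfold Matrix.IsSymm
    rw [Matrix.transpose_sum]
    exact Finset.sum_congr rfl fun l hl => (hfree l (Or.inl (Finset.mem_filter.1 hl).2)).eq
  have hP₀ : (Sum.elim (fun l : {l // d l ≠ E ∧ d l ≠ Ef} => S l.1)
      (fun _ => ∑ l ∈ Finset.univ.filter (fun l => d l = Ef), S l) (Sum.inr ())).IsSymm := by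
    simp only [Sum.elim_inr]
    unfold Matrix.IsSymm
    rw [Matrix.transpose_sum]
    exact Finset.sum_congr rfl fun l hl => (hfree l (Or.inr (Finset.mem_filter.1 hl).2)).eq
  rcases Nat.lt_or_gt_of_ne hEf with hlt | hgt
  · have := FanLawFourAlt.fanLawFourAlt_lower (κ := {l // d l ≠ E ∧ d l ≠ Ef} ⊕ Unit) E
      (Sum.elim (fun l => d l.1) (fun _ => Ef))
      (∑ l ∈ Finset.univ.filter (fun l => d l = E), S l)
      (Sum.elim (fun l => S l.1) (fun _ => ∑ l ∈ Finset.univ.filter (fun l => d l = Ef), S l)) (Sum.inr ())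
      hJ hP₀ (by simpa using hlt) (fun k hk => ?_) N τ hτ hτpos halt
    · simpa using this
    · rcases k with l | u
      · simp only [Sum.elim_inl, Sum.elim_inr]
        rcases hfan l.1 l.2.1 l.2.2 with ⟨_, h⟩ | ⟨h, _⟩
        · exact h
        · exact absurd h (by omega)
      · exact absurd rfl hk
  · have := FanLawFourAlt.fanLawFourAlt_upper (κ := {l // d l ≠ E ∧ d l ≠ Ef} ⊕ Unit) E
      (Sum.elim (fun l => d l.1) (fun _ => Ef))
      (∑ l ∈ Finset.univ.filter (fun l => d l = E), S l)
      (Sum.elim (fun l => S l.1) (fun _ => ∑ l ∈ Finset.univ.filter (fun l => d l = Ef), S l)) (Sum.inr ())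
      hJ hP₀ (by simpa using hgt) (fun k hk => ?_) N τ hτ hτpos halt
    · simpa using this
    · rcases k with l | u
      · simp only [Sum.elim_inl, Sum.elim_inr]
        rcases hfan l.1 l.2.1 l.2.2 with ⟨h, _⟩ | ⟨_, h⟩
        · exact absurd h (by omega)
        · exact h
      · exact absurd rfl hk

end FanLawFourWord

end Summit.ValiantsHypothesis.ValiantsHypothesis.Theorems.LacunarySymmetroidMatrixDescartes
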